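import Summits.BirchSwinnertonDyer.BirchSwinnertonDyer.Theorems.LambdaTransportDoorAtTwoMatsunoClassParityStrata
import HarnessLib

/-!
# The `λ₂ = 2` stratum of the good-ordinary-at-`2` locus: the dictionary `P_E ⟷ {L(E,1), L(E^{(2)},1), L(E,χ₁₆,1), w(E)}` for EVERY `E/ℚ`

Cell bsd-rank2, seat p2, GEN 68, part K68-A (sequel to GEN 67 parts E2/E3, which proved all of this ON THE CLASS `𝒞(15A8)` only).
THEOREMS ONLY (no `def`, no `instance`, no notation, no `sorry`); Barrier-B1 honest: every statement is about `L`-VALUES, the ROOT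
NUMBER and the SHAPE of the distinguished polynomial of the `2`-adic `L`-function — no rank is bounded from below, BSD is proved for
no curve, no S0 motion.  Named fact displayed: `hmod : exists_isNewformOf` (modularity of the quadratic twist `E^{(2)}`), and only
in the statements that mention `L(E^{(2)}, 1)`.

SETTING.  `E = W/ℚ` globally minimal, GOOD ORDINARY AT `2` (`hord`), `F` its newform, `L ∈ Λ₂ = ℤ₂⟦T⟧` an integral lift of
`L₂(E,T) = L₂(F, α_E, T)` (`ι L = L₂(E,T)`; such a lift exists and is unique for every such `E`,
`exists_iwasawaToPowerSeries_eq_padicLFunction_two_auto`), and `λ(L) = 2` (`hlam`) — the `λ₂ = 2` STRATUM.  GEN 67 D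
(`normalForm_of_eq_padicLFunction`, the `ι`-symmetry of the `2`-adic functional equation) puts every such `L` in NORMAL FORM
`pfree L = (T² + aT + b)·U`, `U ∈ Λ₂ˣ`, `a, b ∈ 2ℤ₂`, with `a = b` (FIRST FAMILY `P_E = T² + a(T+1)`) or `(a, b) = (2, 0)`
(SECOND FAMILY `P_E = T(T+2)`).  This file reads EVERY classical invariant the tree can reach off `(a, b)`, for every such `E`:

* §1 `normalForm`; §2 THE DICTIONARY: `L(E,1) = 0 ⟺ b = 0` · `L(E^{(2)},1) = 0 ⟺ 4 − 2a + b = 0` [hmod] ·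
  `L(E,χ,1) = 0 ⟺ (1+T)^{2^{m−3}} + 1 ∣ L` for `χ` even primitive of conductor `2^m`, `m ≥ 3` (conductor `8`: `⟺ T + 2 ∣ L`;
  conductor `16`: `⟺ a = b = 2`; conductor `≥ 32`: NEVER on the stratum — `twistedLValue_ne_zero_of_conductor_ge`, and for every
  good-ordinary-at-`2` curve as soon as `2^{m−3} > λ(L)`, `twistedLValue_ne_zero_of_lam_lt`, an EFFECTIVE Rohrlich bound at `p = 2`);
* §3 THE SIGN: `w(E) = −1 ⟺ (a,b) = (2,0)` (`P_E = T(T+2)`), `w(E) = +1 ⟺ a = b` (`P_E = T² + a(T+1)`);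
* §4 ★ THE EVEN STRATUM `w(E) = +1`: `P_E = T² + a(T+1)` and the three vanishings are `a = 0` / `a = 4` / `a = 2` — so
  **AT MOST ONE of `L(E,1)`, `L(E^{(2)},1)`, `L(E,χ₁₆,1)` vanishes** (`atMostOne_vanishes_of_rootNumber_eq_one`), and
  ★ THE EVEN-RANK DOOR: `w(E) = +1 ∧ L(E,1) = 0` (even analytic rank `≥ 2`) `⟹ P_E = T²`, `ord_T L₂(E,T) = 2` EXACTLY, and
  `L(E,χ,1) ≠ 0` for EVERY even primitive `χ` of `2`-power conductor and `L(E^{(2)},1) ≠ 0` (`evenRankDoor`);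
  THE ODD STRATUM `w(E) = −1`: `P_E = T(T+2)`, `ord_T L₂(E,T) = 1` exactly, `L(E,1) = 0`, `L(E^{(2)},1) = 0` [hmod] and no twist of
  conductor `≥ 16` vanishes (`oddStratum`);
* §5 `strata`: the stratum is the disjoint union `L(E,1) ≠ 0` [`P_E = T² + a(T+1)`, `a ≠ 0`] ⊔ `w = −1` [`T(T+2)`] ⊔ `w = +1 ∧ L(E,1) = 0` [`T²`].
NEW relative to the tree: GEN 67 E2/E3 (`…MatsunoClassNormalForm`/`…ParityStrata`/`…TwistedLValues`) prove these ON `𝒞(15A8)`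
(`λ = 2` by Matsuno); here the class is replaced by the two hypotheses it supplied (`hord`, `hlam`), so the dictionary holds on the
whole stratum; the budget files `Rank1Residual/Iwasawa/LambdaInvariantZeros*` give cumulative INEQUALITIES, these are EQUIVALENCES.
References: Mazur–Tate–Teitelbaum, Invent. Math. 84 (1986) §I.8, §I.12, §I.14, §I.17–18; Greenberg, LNM 1716 §5 (p. 181);
Washington, GTM 83 §7.1–7.2 (Thm. 7.3); Rohrlich, Invent. Math. 75 (1984), Theorem p. 409.
-/

-- planner-bsd-rank2-p2-g68-0 (cell bsd-rank2, seat p2, GEN 68, part K68-A)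
set_option linter.dupNamespace false
set_option autoImplicit false

noncomputable section

open scoped Classical MatrixGroups ModularForm NumberField

open PowerSeries CongruenceSubgroup WeierstrassCurve Literature.NumberTheory.EllipticCurves
  Literature.NumberTheory.EllipticCurves.ModularForms Literature.NumberTheory.EllipticCurves.IwasawaAlgebra
  Literature.NumberTheory.EllipticCurves.Rank1Residual Literature.NumberTheory.EllipticCurves.Rank1Residual.Typed
  Summit.BirchSwinnertonDyer.Rank1Residual.X1.MuLambda Summit.BirchSwinnertonDyer.Rank1Residual.X1.ParitySqueeze
  Summit.BirchSwinnertonDyer.Rank1Residual.Iwasawa Summit.BirchSwinnertonDyer.Rank2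
  Summit.BirchSwinnertonDyer.BirchSwinnertonDyer.Theorems.LambdaTransportDoorAtTwoMainConjecture
  Summit.BirchSwinnertonDyer.BirchSwinnertonDyer.Theorems.LambdaTransportDoorAtTwoNuTwoCriterion
  Summit.BirchSwinnertonDyer.BirchSwinnertonDyer.Theorems.LambdaTransportDoorAtTwoNuTwoConstantTerm
  Summit.BirchSwinnertonDyer.BirchSwinnertonDyer.Theorems.LambdaTransportDoorIotaSymmetryLambdaTwo
  Summit.BirchSwinnertonDyer.BirchSwinnertonDyer.Theorems.LambdaTransportDoorTwistedLValueBridge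
  Summit.BirchSwinnertonDyer.BirchSwinnertonDyer.Theorems.LambdaTransportDoorAtTwoMatsunoClassAdditiveTwist
  Summit.BirchSwinnertonDyer.BirchSwinnertonDyer.Theorems.LambdaTransportDoorAtTwoMatsunoClassTwistedLValues
  Summit.BirchSwinnertonDyer.BirchSwinnertonDyer.Theorems.LambdaTransportDoorAtTwoMatsunoClassNormalForm
  Summit.BirchSwinnertonDyer.BirchSwinnertonDyer.Theorems.LambdaTransportDoorAtTwoMatsunoClassParityStrata

namespace Summit.BirchSwinnertonDyer.BirchSwinnertonDyer.Theorems.LambdaTransportDoorLambdaTwoStratumAtTwo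

variable {W : WeierstrassCurve ℚ} [W.IsElliptic] [W.IsGloballyMinimal] [NeZero (W.conductorNorm ℤ)]

/-! ## §1 Lifts and the normal form on the stratum -/

/-- An integral lift of `L₂(E,T)` is non-zero (`L₂(E,T) ≠ 0`, Rohrlich). [cite: RohrlichInventiones1984, Theorem (p. 409)] -/
theorem lift_ne_zero (hord : IsOrdinaryAt W 2) {F : CuspForm (Gamma0 (W.conductorNorm ℤ)) 2} (hF : IsNewformOf W F)
    {L : IwasawaAlgebra 2} (hL : iwasawaToPowerSeries 2 L = padicLFunction F (unitRoot W 2 : ℚ_[2])) : L ≠ 0 := by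
  intro h
  rw [h, map_zero] at hL
  exact padicLFunction_unitRoot_ne_zero hord hF hL.symm

/-- ★ **NORMAL FORM ON THE `λ₂ = 2` STRATUM**: for `E` good ordinary at `2` and an integral lift `L` of `L₂(E,T)` with `λ(L) = 2`:
`pfree L = (T² + aT + b)·U`, `U ∈ Λ₂ˣ`, `a, b ∈ 2ℤ₂`, and `a = b` or `(a, b) = (2, 0)` (GEN 67 D, the `ι`-symmetry).
[cite: MazurTateTeitelbaum1986Invent, §I.17] [cite: Washington1997, §7.1 Thm. 7.3] -/
theorem normalForm (hord : IsOrdinaryAt W 2) {F : CuspForm (Gamma0 (W.conductorNorm ℤ)) 2} (hF : IsNewformOf W F)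
    {L : IwasawaAlgebra 2} (hL : iwasawaToPowerSeries 2 L = padicLFunction F (unitRoot W 2 : ℚ_[2])) (hlam : lam L = 2) :
    ∃ (a b : ℤ_[2]) (U : ℤ_[2]⟦X⟧), IsUnit U ∧ a ∈ IsLocalRing.maximalIdeal ℤ_[2] ∧ b ∈ IsLocalRing.maximalIdeal ℤ_[2] ∧
      pfree L = (X ^ 2 + C a * X + C b) * U ∧ (a = b ∨ (b = 0 ∧ a = 2)) := by
  have hb : iwasawaToPowerSeries 2 L = PowerSeries.C (1 : ℚ_[2]) * padicLFunction F (unitRoot W 2 : ℚ_[2]) := by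
    rw [map_one, one_mul]; exact hL
  exact normalForm_of_eq_padicLFunction hord hF hb (lift_ne_zero hord hF hL) hlam

/-! ## §2 The dictionary -/

/-- **`L(E,1) = 0 ⟺ b = 0`** for `pfree L = (T² + aT + b)·U` (`⟺ T ∣ L`). [cite: MazurTateTeitelbaum1986Invent, §I.14 (14.3)] -/
theorem entireLFunction_one_eq_zero_iff (hord : IsOrdinaryAt W 2) {F : CuspForm (Gamma0 (W.conductorNorm ℤ)) 2} (hF : IsNewformOf W F)
    {L : IwasawaAlgebra 2} (hL : iwasawaToPowerSeries 2 L = padicLFunction F (unitRoot W 2 : ℚ_[2]))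
    {a b : ℤ_[2]} {U : ℤ_[2]⟦X⟧} (hfac : pfree L = (X ^ 2 + C a * X + C b) * U) (hU : IsUnit U) :
    W.entireLFunction 1 = 0 ↔ b = 0 := by
  rw [← X_dvd_iff_entireLFunction_one_eq_zero hord hF hL, dvd_iff_dvd_pfree X_prime (fun k hk ↦ ?_) L,
    X_dvd_normalForm_iff hfac hU]
  rw [X_dvd_iff, constantCoeff_C] at hk
  exact C_pow_ne_zero (p := 2) k (by rw [hk, map_zero])

/-- **`L(E^{(2)},1) = 0 ⟺ 4 − 2a + b = 0`** [hmod] (`⟺ T + 2 ∣ L`; `4 − 2a + b = P_E(−2)`, the second fixed point of `ι`).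
[cite: MazurTateTeitelbaum1986Invent, §I.8 (8.6), §I.14] [cite: Washington1997, §7.1 Prop. 7.2] -/
theorem apply_one_quadraticTwist_two_eq_zero_iff (hmod : exists_isNewformOf) (hord : IsOrdinaryAt W 2)
    {F : CuspForm (Gamma0 (W.conductorNorm ℤ)) 2} (hF : IsNewformOf W F)
    {L : IwasawaAlgebra 2} (hL : iwasawaToPowerSeries 2 L = padicLFunction F (unitRoot W 2 : ℚ_[2]))
    {a b : ℤ_[2]} {U : ℤ_[2]⟦X⟧} (hfac : pfree L = (X ^ 2 + C a * X + C b) * U) (hU : IsUnit U) :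
    (W.quadraticTwist 2).entireLFunction 1 = 0 ↔ 4 - 2 * a + b = 0 := by
  rw [← X_add_C_two_dvd_iff_apply_one_quadraticTwist_two_eq_zero hmod hord hF hL,
    dvd_iff_dvd_pfree prime_X_add_C_two not_X_add_C_two_dvd_C_pow L,
    X_add_C_dvd_normalForm_iff two_mem_maximalIdeal hfac hU]
  constructor <;> intro h <;> linear_combination h

/-- ★ **THE CONDUCTOR-`2^m` DICTIONARY FOR EVERY GOOD-ORDINARY-AT-`2` CURVE** (no `λ` hypothesis): for `m ≥ 3`, `χ` an even
primitive Dirichlet character mod `2^m` and `Lχ` any entire continuation of `L(F, χ, s)`: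
**`Lχ(1) = 0 ⟺ (1+T)^{2^{m−3}} + 1 ∣ L`** (`= Φ_{2^{m−2}}(1+T)`; GEN 67 B at `p = 2`, `e₀ = 2`).
[cite: MazurTateTeitelbaum1986Invent, §I.8 (8.6), §I.14 (14.3)] -/
theorem twistedLValue_eq_zero_iff_dvd (hord : IsOrdinaryAt W 2) {F : CuspForm (Gamma0 (W.conductorNorm ℤ)) 2}
    (hF : IsNewformOf W F) {L : IwasawaAlgebra 2} (hL : iwasawaToPowerSeries 2 L = padicLFunction F (unitRoot W 2 : ℚ_[2]))
    {m : ℕ} (hm : 3 ≤ m) (χ : DirichletCharacter ℂ (2 ^ m)) (hχ : χ.IsPrimitive) (hχe : χ.Even)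
    {Lχ : ℂ → ℂ} (hLd : Differentiable ℂ Lχ) (hLχ : ∀ s : ℂ, 2 < s.re → Lχ s = twistedLSeries F χ s) :
    Lχ 1 = 0 ↔ ((1 + PowerSeries.X) ^ (2 ^ (m - 3)) + 1 : IwasawaAlgebra 2) ∣ L := by
  have hce : cyclotomicExponent 2 = 2 := by rw [cyclotomicExponent, if_pos rfl]
  obtain ⟨n, rfl⟩ : ∃ n, m = n + 1 + cyclotomicExponent 2 := ⟨m - 3, by omega⟩
  have hn : n + 1 + cyclotomicExponent 2 - 3 = n := by omega
  have hg : iwasawaToPowerSeries 2 L = PowerSeries.C (1 : ℚ_[2]) * padicLFunction F (unitRoot W 2 : ℚ_[2]) := by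
    rw [map_one, one_mul]; exact hL
  rw [hn, twistedLValue_eq_zero_iff_cyclotomic_comp_dvd hord hF one_ne_zero hg n χ hχ hχe (exists_orderOf_eq_two_pow _ χ)
    hLd hLχ, coe_cyclotomic_two_pow_comp]

/-- **EFFECTIVE ROHRLICH AT `p = 2`** (no `λ = 2` hypothesis): for every good-ordinary-at-`2` curve with integral lift `L`, every
`m ≥ 3` with **`λ(L) < 2^{m−3}`**, and every even primitive `χ` of conductor `2^m`: **`L(E, χ, 1) ≠ 0`** (every continuation).
On the `λ₂ = 2` stratum: conductor `≥ 32` never vanishes (`twistedLValue_ne_zero_of_conductor_ge`).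
[cite: RohrlichInventiones1984, Theorem (p. 409)] [cite: Washington1997, §7.1–7.2] [cite: MazurTateTeitelbaum1986Invent, §I.14] -/
theorem twistedLValue_ne_zero_of_lam_lt (hord : IsOrdinaryAt W 2) {F : CuspForm (Gamma0 (W.conductorNorm ℤ)) 2}
    (hF : IsNewformOf W F) {L : IwasawaAlgebra 2} (hL : iwasawaToPowerSeries 2 L = padicLFunction F (unitRoot W 2 : ℚ_[2]))
    {m : ℕ} (hm : 3 ≤ m) (hlam : lam L < 2 ^ (m - 3)) (χ : DirichletCharacter ℂ (2 ^ m)) (hχ : χ.IsPrimitive) (hχe : χ.Even)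
    {Lχ : ℂ → ℂ} (hLd : Differentiable ℂ Lχ) (hLχ : ∀ s : ℂ, 2 < s.re → Lχ s = twistedLSeries F χ s) :
    Lχ 1 ≠ 0 := by
  rw [Ne, twistedLValue_eq_zero_iff_dvd hord hF hL hm χ hχ hχe hLd hLχ]
  exact not_one_add_X_pow_add_one_dvd_of_lam_lt (lift_ne_zero hord hF hL) hlam

/-- **Conductor `≥ 32` never vanishes on the `λ₂ = 2` stratum** (`2 < 2^{m−3}` for `m ≥ 5`).
[cite: RohrlichInventiones1984, Theorem (p. 409)] [cite: Washington1997, §7.1–7.2] -/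
theorem twistedLValue_ne_zero_of_conductor_ge (hord : IsOrdinaryAt W 2) {F : CuspForm (Gamma0 (W.conductorNorm ℤ)) 2}
    (hF : IsNewformOf W F) {L : IwasawaAlgebra 2} (hL : iwasawaToPowerSeries 2 L = padicLFunction F (unitRoot W 2 : ℚ_[2]))
    (hlam : lam L = 2) {m : ℕ} (hm : 5 ≤ m) (χ : DirichletCharacter ℂ (2 ^ m)) (hχ : χ.IsPrimitive) (hχe : χ.Even)
    {Lχ : ℂ → ℂ} (hLd : Differentiable ℂ Lχ) (hLχ : ∀ s : ℂ, 2 < s.re → Lχ s = twistedLSeries F χ s) :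
    Lχ 1 ≠ 0 := by
  refine twistedLValue_ne_zero_of_lam_lt hord hF hL (by omega) ?_ χ hχ hχe hLd hLχ
  rw [hlam]
  calc (2 : ℕ) < 2 ^ 2 := by norm_num
    _ ≤ 2 ^ (m - 3) := Nat.pow_le_pow_right (by norm_num) (by omega)

/-- **Conductor `8`** (the quadratic character `χ₈ = (2/·)`; no `λ` hypothesis): **`L(E, χ₈, 1) = 0 ⟺ T + 2 ∣ L`**, and [hmod]
**`⟺ L(E^{(2)}, 1) = 0`**. [cite: MazurTateTeitelbaum1986Invent, §I.14 Proposition (p. 20)] -/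
theorem twistedLValue_eight_eq_zero_iff (hord : IsOrdinaryAt W 2) {F : CuspForm (Gamma0 (W.conductorNorm ℤ)) 2}
    (hF : IsNewformOf W F) {L : IwasawaAlgebra 2} (hL : iwasawaToPowerSeries 2 L = padicLFunction F (unitRoot W 2 : ℚ_[2]))
    (χ : DirichletCharacter ℂ (2 ^ 3)) (hχ : χ.IsPrimitive) (hχe : χ.Even)
    {Lχ : ℂ → ℂ} (hLd : Differentiable ℂ Lχ) (hLχ : ∀ s : ℂ, 2 < s.re → Lχ s = twistedLSeries F χ s) :
    (Lχ 1 = 0 ↔ (PowerSeries.X + PowerSeries.C (2 : ℤ_[2]) : IwasawaAlgebra 2) ∣ L) ∧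
      (exists_isNewformOf → (Lχ 1 = 0 ↔ (W.quadraticTwist 2).entireLFunction 1 = 0)) := by
  have h1 := twistedLValue_eq_zero_iff_dvd hord hF hL (le_refl 3) χ hχ hχe hLd hLχ
  rw [show (2 : ℕ) ^ (3 - 3) = 2 ^ 0 by norm_num, one_add_X_pow_one_add_one] at h1
  exact ⟨h1, fun hmod ↦ h1.trans (X_add_C_two_dvd_iff_apply_one_quadraticTwist_two_eq_zero hmod hord hF hL)⟩

/-- **Conductor `16`** (no `λ` hypothesis): **`L(E, χ₁₆, 1) = 0 ⟺ T² + 2T + 2 ∣ L`** (`ν₂ = Φ₄(1+T)`).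
[cite: MazurTateTeitelbaum1986Invent, §I.14 (14.3)] [cite: Washington1997, §7.2] -/
theorem twistedLValue_sixteen_eq_zero_iff_dvd (hord : IsOrdinaryAt W 2) {F : CuspForm (Gamma0 (W.conductorNorm ℤ)) 2}
    (hF : IsNewformOf W F) {L : IwasawaAlgebra 2} (hL : iwasawaToPowerSeries 2 L = padicLFunction F (unitRoot W 2 : ℚ_[2]))
    (χ : DirichletCharacter ℂ (2 ^ 4)) (hχ : χ.IsPrimitive) (hχe : χ.Even)
    {Lχ : ℂ → ℂ} (hLd : Differentiable ℂ Lχ) (hLχ : ∀ s : ℂ, 2 < s.re → Lχ s = twistedLSeries F χ s) :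
    Lχ 1 = 0 ↔ (PowerSeries.X * PowerSeries.X + PowerSeries.C (2 : ℤ_[2]) * PowerSeries.X + PowerSeries.C (2 : ℤ_[2]) :
      IwasawaAlgebra 2) ∣ L := by
  have h1 := twistedLValue_eq_zero_iff_dvd hord hF hL (by norm_num : 3 ≤ 4) χ hχ hχe hLd hLχ
  rwa [show (2 : ℕ) ^ (4 - 3) = 2 ^ 1 by norm_num, one_add_X_pow_two_add_one] at h1

/-- **`L(E, χ₁₆, 1) = 0 ⟺ a = b = 2`** for `pfree L = (T² + aT + b)·U` (`⟺ P_E = ν₂ = T² + 2T + 2`, rigidity of the normal form).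
[cite: MazurTateTeitelbaum1986Invent, §I.14] [cite: Washington1997, §7.1 Thm. 7.3] -/
theorem twistedLValue_sixteen_eq_zero_iff (hord : IsOrdinaryAt W 2) {F : CuspForm (Gamma0 (W.conductorNorm ℤ)) 2}
    (hF : IsNewformOf W F) {L : IwasawaAlgebra 2} (hL : iwasawaToPowerSeries 2 L = padicLFunction F (unitRoot W 2 : ℚ_[2]))
    {a b : ℤ_[2]} {U : ℤ_[2]⟦X⟧} (ha : a ∈ IsLocalRing.maximalIdeal ℤ_[2]) (hb : b ∈ IsLocalRing.maximalIdeal ℤ_[2])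
    (hfac : pfree L = (X ^ 2 + C a * X + C b) * U) (hU : IsUnit U)
    (χ : DirichletCharacter ℂ (2 ^ 4)) (hχ : χ.IsPrimitive) (hχe : χ.Even)
    {Lχ : ℂ → ℂ} (hLd : Differentiable ℂ Lχ) (hLχ : ∀ s : ℂ, 2 < s.re → Lχ s = twistedLSeries F χ s) :
    Lχ 1 = 0 ↔ (a = 2 ∧ b = 2) := by
  rw [twistedLValue_sixteen_eq_zero_iff_dvd hord hF hL χ hχ hχe hLd hLχ, dvd_iff_dvd_pfree prime_nu_two not_nu_two_dvd_C_pow L]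
  have hν : (PowerSeries.X * PowerSeries.X + PowerSeries.C (2 : ℤ_[2]) * PowerSeries.X + PowerSeries.C (2 : ℤ_[2]) :
      IwasawaAlgebra 2) = X ^ 2 + C (2 : ℤ_[2]) * X + C (2 : ℤ_[2]) := by rw [sq]
  constructor
  · intro h
    rw [hν] at h
    obtain ⟨h1, h2⟩ := eq_of_quadratic_dvd_normalForm ha hb two_mem_maximalIdeal two_mem_maximalIdeal hfac hU h
    exact ⟨h1.symm, h2.symm⟩
  · rintro ⟨rfl, rfl⟩
    rw [hν, hfac]
    exact dvd_mul_right _ _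

/-! ## §3 The sign -/

/-- ★ **`w(E) = −1 ⟺ P_E = T(T+2)`**: in the normal form (`a = b` or `(a,b) = (2,0)`), `W.rootNumber = −1 ⟺ (a, b) = (2, 0)`
(`w(E) = (−1)^{ord_T L₂(E,T)}`, the `2`-adic functional equation at the conductor level).
[cite: MazurTateTeitelbaum1986Invent, §I.17–§I.18] [cite: GreenbergLNM1716, §5 (p. 181)] [cite: Washington1997, §7.1 Thm. 7.3] -/
theorem rootNumber_eq_neg_one_iff (hord : IsOrdinaryAt W 2) {F : CuspForm (Gamma0 (W.conductorNorm ℤ)) 2} (hF : IsNewformOf W F)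
    {L : IwasawaAlgebra 2} (hL : iwasawaToPowerSeries 2 L = padicLFunction F (unitRoot W 2 : ℚ_[2]))
    {a b : ℤ_[2]} {U : IwasawaAlgebra 2} (hfac : pfree L = (X ^ 2 + C a * X + C b) * U) (hU : IsUnit U)
    (hab : a = b ∨ (b = 0 ∧ a = 2)) :
    W.rootNumber = -1 ↔ (a = 2 ∧ b = 0) := by
  have hfacL : L = C ((2 : ℤ_[2]) ^ mu L) * ((X ^ 2 + C a * X + C b) * U) := by
    rw [← hfac]; exact_mod_cast eq_C_pow_mu_mul_pfree L
  obtain ⟨h0, h1, h2⟩ := order_eq_of_normalForm hfacL hU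
  have hsign := rootNumber_eq_neg_one_pow_order hord hF hL
  constructor
  · intro hw
    rw [hw] at hsign
    push_cast at hsign
    have hodd : Odd L.order.toNat := (neg_one_pow_eq_neg_one_iff_odd (by norm_num)).mp hsign.symm
    have hb : b = 0 := by
      by_contra hb
      rw [h0 hb] at hodd
      exact (Nat.not_odd_iff_even.mpr (by decide)) hodd
    have ha : a ≠ 0 := by
      intro ha
      rw [h2 hb ha] at hodd
      exact (Nat.not_odd_iff_even.mpr (by decide)) hodd
    rcases hab with rfl | ⟨-, rfl⟩
    · exact absurd hb ha
    · exact ⟨rfl, hb⟩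
  · rintro ⟨rfl, rfl⟩
    rw [h1 rfl two_ne_zero] at hsign
    have : ((W.rootNumber : ℤ) : ℚ_[2]) = ((-1 : ℤ) : ℚ_[2]) := by rw [hsign]; push_cast; rfl
    exact_mod_cast this

/-- ★ **`w(E) = +1 ⟺ P_E = T² + a(T+1)`**: in the normal form, `W.rootNumber = 1 ⟺ a = b`.
[cite: MazurTateTeitelbaum1986Invent, §I.17–§I.18] [cite: GreenbergLNM1716, §5 (p. 181)] -/
theorem rootNumber_eq_one_iff (hord : IsOrdinaryAt W 2) {F : CuspForm (Gamma0 (W.conductorNorm ℤ)) 2} (hF : IsNewformOf W F)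
    {L : IwasawaAlgebra 2} (hL : iwasawaToPowerSeries 2 L = padicLFunction F (unitRoot W 2 : ℚ_[2]))
    {a b : ℤ_[2]} {U : IwasawaAlgebra 2} (hfac : pfree L = (X ^ 2 + C a * X + C b) * U) (hU : IsUnit U)
    (hab : a = b ∨ (b = 0 ∧ a = 2)) :
    W.rootNumber = 1 ↔ a = b := by
  have hneg := rootNumber_eq_neg_one_iff hord hF hL hfac hU hab
  rcases rootNumber_eq_one_or_eq_neg_one (W := W) with hw | hw
  · refine ⟨fun _ ↦ ?_, fun _ ↦ hw⟩
    rcases hab with h | ⟨hb, ha⟩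
    · exact h
    · have : W.rootNumber = -1 := hneg.mpr ⟨ha, hb⟩
      omega
  · refine ⟨fun h ↦ by omega, fun h ↦ ?_⟩
    obtain ⟨ha, hb⟩ := hneg.mp hw
    have h22 : (2 : ℤ_[2]) = 0 := by rw [← ha, h, hb]
    exact absurd h22 two_ne_zero

omit [W.IsElliptic] [NeZero (W.conductorNorm ℤ)] in
/-- **`ord_T L₂(E,T)` on the stratum**: with `ι L = L₂(E,T)` in normal form, `ord_T L₂(E,T) = 0 / 1 / 2` according as
`b ≠ 0` / `b = 0 ≠ a` / `a = b = 0`. [cite: MazurTateTeitelbaum1986Invent, §I.12] [cite: Washington1997, §7.1] -/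
theorem order_padicLFunction_eq {F : CuspForm (Gamma0 (W.conductorNorm ℤ)) 2}
    {L : IwasawaAlgebra 2} (hL : iwasawaToPowerSeries 2 L = padicLFunction F (unitRoot W 2 : ℚ_[2]))
    {a b : ℤ_[2]} {U : IwasawaAlgebra 2} (hfac : pfree L = (X ^ 2 + C a * X + C b) * U) (hU : IsUnit U) :
    (b ≠ 0 → (padicLFunction F (unitRoot W 2 : ℚ_[2])).order = 0) ∧
      (b = 0 → a ≠ 0 → (padicLFunction F (unitRoot W 2 : ℚ_[2])).order = 1) ∧
        (b = 0 → a = 0 → (padicLFunction F (unitRoot W 2 : ℚ_[2])).order = 2) := by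
  have hfacL : L = C ((2 : ℤ_[2]) ^ mu L) * ((X ^ 2 + C a * X + C b) * U) := by
    rw [← hfac]; exact_mod_cast eq_C_pow_mu_mul_pfree L
  obtain ⟨h0, h1, h2⟩ := order_eq_of_normalForm hfacL hU
  rw [← hL, order_iota L]
  exact ⟨h0, h1, h2⟩

/-! ## §4 The even stratum, the mutual exclusion, the even-rank door; the odd stratum -/

/-- ★★ **THE EVEN STRATUM `w(E) = +1`**: `P_E = T² + a(T+1)` with `a ∈ 2ℤ₂`, and the three vanishings are three VALUES of `a`:
**`L(E,1) = 0 ⟺ a = 0`**, **`L(E,χ₁₆,1) = 0 ⟺ a = 2`** (every even primitive `χ₁₆` mod `16`, every continuation), and [hmod]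
**`L(E^{(2)},1) = 0 ⟺ a = 4`**. [cite: MazurTateTeitelbaum1986Invent, §I.14, §I.17–§I.18] [cite: Washington1997, §7.1 Thm. 7.3] -/
theorem evenStratum (hord : IsOrdinaryAt W 2) {F : CuspForm (Gamma0 (W.conductorNorm ℤ)) 2} (hF : IsNewformOf W F)
    {L : IwasawaAlgebra 2} (hL : iwasawaToPowerSeries 2 L = padicLFunction F (unitRoot W 2 : ℚ_[2])) (hlam : lam L = 2)
    (hw : W.rootNumber = 1) :
    ∃ (a : ℤ_[2]) (U : ℤ_[2]⟦X⟧), a ∈ IsLocalRing.maximalIdeal ℤ_[2] ∧ IsUnit U ∧ pfree L = (X ^ 2 + C a * (X + 1)) * U ∧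
      (W.entireLFunction 1 = 0 ↔ a = 0) ∧
      (∀ (χ : DirichletCharacter ℂ (2 ^ 4)), χ.IsPrimitive → χ.Even → ∀ {Lχ : ℂ → ℂ}, Differentiable ℂ Lχ →
          (∀ s : ℂ, 2 < s.re → Lχ s = twistedLSeries F χ s) → (Lχ 1 = 0 ↔ a = 2)) ∧
      (exists_isNewformOf → ((W.quadraticTwist 2).entireLFunction 1 = 0 ↔ a = 4)) := by
  obtain ⟨a, b, U, hU, ha, hb, hfac, hab⟩ := normalForm hord hF hL hlam
  obtain rfl : a = b := (rootNumber_eq_one_iff hord hF hL hfac hU hab).mp hw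
  refine ⟨a, U, ha, hU, by rw [hfac]; ring, entireLFunction_one_eq_zero_iff hord hF hL hfac hU,
    fun χ hχ hχe Lχ hLd hLχ ↦ ?_, fun hmod ↦ ?_⟩
  · rw [twistedLValue_sixteen_eq_zero_iff hord hF hL ha ha hfac hU χ hχ hχe hLd hLχ, and_self]
  · rw [apply_one_quadraticTwist_two_eq_zero_iff hmod hord hF hL hfac hU]
    have h2 : (2 : ℤ_[2]) ≠ 0 := two_ne_zero
    constructor
    · intro h
      have : a = 4 := by linear_combination (-1 : ℤ_[2]) * h
      exact this
    · rintro rfl; ring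

/-- ★★★ **MUTUAL EXCLUSION ON THE EVEN STRATUM**: for `E` good ordinary at `2` with `λ₂(E) = 2` and `w(E) = +1`,
**AT MOST ONE of `L(E,1)`, `L(E,χ₁₆,1)`, `L(E^{(2)},1)` vanishes** (they are `a = 0`, `a = 2`, `a = 4` for the one parameter `a` of
`P_E = T² + a(T+1)`; the statements about `L(E^{(2)},1)` carry [hmod]).  B1: `L`-values only.
[cite: MazurTateTeitelbaum1986Invent, §I.14, §I.17] [cite: Washington1997, §7.1] -/
theorem atMostOne_vanishes_of_rootNumber_eq_one (hord : IsOrdinaryAt W 2) {F : CuspForm (Gamma0 (W.conductorNorm ℤ)) 2}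
    (hF : IsNewformOf W F) {L : IwasawaAlgebra 2} (hL : iwasawaToPowerSeries 2 L = padicLFunction F (unitRoot W 2 : ℚ_[2]))
    (hlam : lam L = 2) (hw : W.rootNumber = 1)
    (χ : DirichletCharacter ℂ (2 ^ 4)) (hχ : χ.IsPrimitive) (hχe : χ.Even)
    {Lχ : ℂ → ℂ} (hLd : Differentiable ℂ Lχ) (hLχ : ∀ s : ℂ, 2 < s.re → Lχ s = twistedLSeries F χ s) :
    (W.entireLFunction 1 = 0 → Lχ 1 ≠ 0) ∧
      (exists_isNewformOf → W.entireLFunction 1 = 0 → (W.quadraticTwist 2).entireLFunction 1 ≠ 0) ∧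
        (exists_isNewformOf → Lχ 1 = 0 → (W.quadraticTwist 2).entireLFunction 1 ≠ 0) := by
  obtain ⟨a, U, -, -, -, h0, h16, h8⟩ := evenStratum hord hF hL hlam hw
  have h16' := h16 χ hχ hχe hLd hLχ
  refine ⟨fun h1 h2 ↦ ?_, fun hmod h1 h2 ↦ ?_, fun hmod h1 h2 ↦ ?_⟩
  · rw [h0] at h1; rw [h16'] at h2
    exact absurd (h1.symm.trans h2) (by norm_num)
  · rw [h0] at h1; rw [h8 hmod] at h2
    exact absurd (h1.symm.trans h2) (by norm_num)
  · rw [h16'] at h1; rw [h8 hmod] at h2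
    have h24 : (4 : ℤ_[2]) - 2 = 0 := by rw [← h2, h1]; ring
    norm_num at h24

/-- ★★★ **THE EVEN-RANK DOOR ON THE STRATUM**: for `E` good ordinary at `2` with `λ₂(E) = 2`, **`w(E) = +1` and `L(E,1) = 0`**
(even analytic rank `≥ 2`) imply: `pfree L = T²·U` (`P_E = T²`), **`ord_T L₂(E,T) = 2` EXACTLY**, **`L(E,χ,1) ≠ 0` for EVERY even
primitive `χ` of conductor `2^m`, every `m ≥ 3`, every continuation**, and [hmod] **`L(E^{(2)},1) ≠ 0`**.  (On the class this was
GEN 66's `twistedLValue_ne_zero_of_rootNumber_eq_one_of_central_zero`.)  B1: an `L`-value statement; no rank is bounded below.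
[cite: MazurTateTeitelbaum1986Invent, §I.14, §I.17] [cite: RohrlichInventiones1984, Theorem (p. 409)] [cite: Washington1997, §7.1] -/
theorem evenRankDoor (hord : IsOrdinaryAt W 2) {F : CuspForm (Gamma0 (W.conductorNorm ℤ)) 2} (hF : IsNewformOf W F)
    {L : IwasawaAlgebra 2} (hL : iwasawaToPowerSeries 2 L = padicLFunction F (unitRoot W 2 : ℚ_[2])) (hlam : lam L = 2)
    (hw : W.rootNumber = 1) (hL1 : W.entireLFunction 1 = 0) :
    (∃ U : ℤ_[2]⟦X⟧, IsUnit U ∧ pfree L = X ^ 2 * U) ∧ (padicLFunction F (unitRoot W 2 : ℚ_[2])).order = 2 ∧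
      (∀ {m : ℕ}, 3 ≤ m → ∀ (χ : DirichletCharacter ℂ (2 ^ m)), χ.IsPrimitive → χ.Even → ∀ {Lχ : ℂ → ℂ},
          Differentiable ℂ Lχ → (∀ s : ℂ, 2 < s.re → Lχ s = twistedLSeries F χ s) → Lχ 1 ≠ 0) ∧
      (exists_isNewformOf → (W.quadraticTwist 2).entireLFunction 1 ≠ 0) := by
  obtain ⟨a, b, U, hU, ha, hb, hfac, hab⟩ := normalForm hord hF hL hlam
  obtain rfl : a = b := (rootNumber_eq_one_iff hord hF hL hfac hU hab).mp hw
  obtain rfl : a = 0 := (entireLFunction_one_eq_zero_iff hord hF hL hfac hU).mp hL1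
  have hfac' : pfree L = X ^ 2 * U := by rw [hfac, map_zero]; ring
  refine ⟨⟨U, hU, hfac'⟩, (order_padicLFunction_eq hL hfac hU).2.2 rfl rfl, fun {m} hm χ hχ hχe Lχ hLd hLχ ↦ ?_,
    fun hmod h ↦ ?_⟩
  · rw [Ne, twistedLValue_eq_zero_iff_dvd hord hF hL hm χ hχ hχe hLd hLχ, eq_C_pow_mu_mul_pfree L, hfac', ← mul_assoc]
    exact_mod_cast not_one_add_X_pow_add_one_dvd_C_mul_X_sq_mul (m - 3) (mu L) hU
  · rw [apply_one_quadraticTwist_two_eq_zero_iff hmod hord hF hL hfac hU] at h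
    norm_num at h

/-- ★★ **THE ODD STRATUM `w(E) = −1`**: `pfree L = T(T+2)·U` (`P_E = T(T+2)`), **`ord_T L₂(E,T) = 1` EXACTLY**, `L(E,1) = 0`,
[hmod] `L(E^{(2)},1) = 0` (the zero at the second fixed point `T = −2` is the quadratic twist's), and **`L(E,χ,1) ≠ 0` for every
even primitive `χ` of conductor `2^m`, `m ≥ 4`**.  B1: an odd-sign curve on the stratum has `2`-adic analytic rank ONE; no rational
point is produced here. [cite: MazurTateTeitelbaum1986Invent, §I.14, §I.17–§I.18] [cite: GreenbergLNM1716, §5 (p. 181)] -/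
theorem oddStratum (hord : IsOrdinaryAt W 2) {F : CuspForm (Gamma0 (W.conductorNorm ℤ)) 2} (hF : IsNewformOf W F)
    {L : IwasawaAlgebra 2} (hL : iwasawaToPowerSeries 2 L = padicLFunction F (unitRoot W 2 : ℚ_[2])) (hlam : lam L = 2)
    (hw : W.rootNumber = -1) :
    (∃ U : ℤ_[2]⟦X⟧, IsUnit U ∧ pfree L = X * (X + C 2) * U) ∧ (padicLFunction F (unitRoot W 2 : ℚ_[2])).order = 1 ∧
      W.entireLFunction 1 = 0 ∧ (exists_isNewformOf → (W.quadraticTwist 2).entireLFunction 1 = 0) ∧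
      (∀ {m : ℕ}, 4 ≤ m → ∀ (χ : DirichletCharacter ℂ (2 ^ m)), χ.IsPrimitive → χ.Even → ∀ {Lχ : ℂ → ℂ},
          Differentiable ℂ Lχ → (∀ s : ℂ, 2 < s.re → Lχ s = twistedLSeries F χ s) → Lχ 1 ≠ 0) := by
  obtain ⟨a, b, U, hU, ha, hb, hfac, hab⟩ := normalForm hord hF hL hlam
  obtain ⟨rfl, rfl⟩ := (rootNumber_eq_neg_one_iff hord hF hL hfac hU hab).mp hw
  refine ⟨⟨U, hU, by rw [hfac, map_zero]; ring⟩, (order_padicLFunction_eq hL hfac hU).2.1 rfl two_ne_zero,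
    (entireLFunction_one_eq_zero_iff hord hF hL hfac hU).mpr rfl,
    fun hmod ↦ (apply_one_quadraticTwist_two_eq_zero_iff hmod hord hF hL hfac hU).mpr (by ring),
    fun {m} hm χ hχ hχe Lχ hLd hLχ ↦ ?_⟩
  rcases Nat.lt_or_ge m 5 with hm5 | hm5
  · obtain rfl : m = 4 := by omega
    rw [Ne, twistedLValue_sixteen_eq_zero_iff hord hF hL ha hb hfac hU χ hχ hχe hLd hLχ]
    rintro ⟨-, h⟩
    exact two_ne_zero h.symm
  · exact twistedLValue_ne_zero_of_conductor_ge hord hF hL hlam hm5 χ hχ hχe hLd hLχ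

/-! ## §5 The three strata -/

/-- ★★ **THE THREE STRATA OF THE `λ₂ = 2` LOCUS**: every good-ordinary-at-`2` curve with `λ₂ = 2` is in exactly one of
(i) `L(E,1) ≠ 0`: `P_E = T² + a(T+1)`, `a ≠ 0` (and `w(E) = +1`); (ii) `w(E) = −1`: `P_E = T(T+2)` (and `L(E,1) = 0`);
(iii) `w(E) = +1 ∧ L(E,1) = 0`: `P_E = T²`. [cite: MazurTateTeitelbaum1986Invent, §I.14, §I.17–§I.18] [cite: GreenbergLNM1716, §5 (p. 181)] -/
theorem strata (hord : IsOrdinaryAt W 2) {F : CuspForm (Gamma0 (W.conductorNorm ℤ)) 2} (hF : IsNewformOf W F)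
    {L : IwasawaAlgebra 2} (hL : iwasawaToPowerSeries 2 L = padicLFunction F (unitRoot W 2 : ℚ_[2])) (hlam : lam L = 2) :
    ∃ U : IwasawaAlgebra 2, IsUnit U ∧
      ((W.entireLFunction 1 ≠ 0 ∧ W.rootNumber = 1 ∧
          ∃ a : ℤ_[2], a ∈ IsLocalRing.maximalIdeal ℤ_[2] ∧ a ≠ 0 ∧ pfree L = (X ^ 2 + C a * (X + 1)) * U) ∨
        (W.entireLFunction 1 = 0 ∧ W.rootNumber = -1 ∧ pfree L = X * (X + C 2) * U) ∨
        (W.entireLFunction 1 = 0 ∧ W.rootNumber = 1 ∧ pfree L = X ^ 2 * U)) := by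
  obtain ⟨a, b, U, hU, ha, hb, hfac, hab⟩ := normalForm hord hF hL hlam
  have hL1 := entireLFunction_one_eq_zero_iff hord hF hL hfac hU
  have hw1 := rootNumber_eq_one_iff hord hF hL hfac hU hab
  have hwn := rootNumber_eq_neg_one_iff hord hF hL hfac hU hab
  refine ⟨U, hU, ?_⟩
  rcases hab with rfl | ⟨rfl, rfl⟩
  · by_cases ha0 : a = 0
    · subst ha0
      exact Or.inr (Or.inr ⟨hL1.mpr rfl, hw1.mpr rfl, by rw [hfac, map_zero]; ring⟩)
    · exact Or.inl ⟨fun h ↦ ha0 (hL1.mp h), hw1.mpr rfl, a, ha, ha0, by rw [hfac]; ring⟩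
  · exact Or.inr (Or.inl ⟨hL1.mpr rfl, hwn.mpr ⟨rfl, rfl⟩, by rw [hfac, map_zero]; ring⟩)

/-- **Lift-free reading** (the lift exists and is unique): for `E` good ordinary at `2` whose (unique) integral lift has `λ = 2`,
`w(E) = +1` and `L(E,1) = 0` imply `ord_T L₂(E,T) = 2` and `L(E, χ, 1) ≠ 0` for every even primitive `χ` of conductor `2^m`, `m ≥ 3`.
[cite: MazurTateTeitelbaum1986Invent, §I.12, §I.14, §I.17] -/
theorem evenRankDoor_liftFree (hord : IsOrdinaryAt W 2) {F : CuspForm (Gamma0 (W.conductorNorm ℤ)) 2} (hF : IsNewformOf W F)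
    (hlam : ∀ L : IwasawaAlgebra 2, iwasawaToPowerSeries 2 L = padicLFunction F (unitRoot W 2 : ℚ_[2]) → lam L = 2)
    (hw : W.rootNumber = 1) (hL1 : W.entireLFunction 1 = 0) :
    (padicLFunction F (unitRoot W 2 : ℚ_[2])).order = 2 ∧
      ∀ {m : ℕ}, 3 ≤ m → ∀ (χ : DirichletCharacter ℂ (2 ^ m)), χ.IsPrimitive → χ.Even → ∀ {Lχ : ℂ → ℂ},
          Differentiable ℂ Lχ → (∀ s : ℂ, 2 < s.re → Lχ s = twistedLSeries F χ s) → Lχ 1 ≠ 0 := by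
  obtain ⟨L, hL⟩ := exists_iwasawaToPowerSeries_eq_padicLFunction_two_auto hord hF
  obtain ⟨-, h2, h3, -⟩ := evenRankDoor hord hF hL (hlam L hL) hw hL1
  exact ⟨h2, h3⟩

end Summit.BirchSwinnertonDyer.BirchSwinnertonDyer.Theorems.LambdaTransportDoorLambdaTwoStratumAtTwo

end
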